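import Literature.MathematicalPhysics.QuantumFieldTheory.Balaban1983to89.B6SectADomainsV1
import Literature.MathematicalPhysics.QuantumFieldTheory.Balaban1983to89.B15DeterminingSets
import Literature.MathematicalPhysics.QuantumFieldTheory.Balaban1983to89.TorusGeometry
import Literature.MathematicalPhysics.QuantumFieldTheory.Balaban1983to89.B10StarCount
import Literature.MathematicalPhysics.QuantumFieldTheory.Balaban1983to89.Node00.DomainsGenSetBridge

/-!
# NODE 00 — the RECORD's region sequence `{Ω_j}` as a V1 nested family: `domainsOfSeq Ω k` (`Ω_j^{(j)} := {y : B^j(y) ⊆ Ω_1 ∩ … ∩ Ω_j}`), its dictionary with the determining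
# set `genSet Ω k` ([III] (2.2)), monotonicity in `Ω`, and the LAYER CONDITION of `Node00/DomainsGenSetBridge` from a set-level collar — the object on which the per-cube
# family `cubeDomains ⊓ domainsOfSeq Ω♭` of [B11] (150) is keyed (k0-s1-w3 ∕ dag-n07-w4: «44c wanted»)

Cell `pub-ymgap` (HUMAN RULINGS D-0062 ∕ D-0088), seat `pub-ymgap-dag-n07-e` g20 (R141 (C) row s3 lineage; DAG node N07 = [B11]; lane owner), 2026-08-28.  `--kind definition
--supports stmt-QuantumFields-20541` (K0⁷; count-neutral).  File C of INTENT-44; companions: `Node00/DomainsRefinement` (p613194, file A), `Node00/DomainsMeet` (file B, the meet),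
`Node00/DomainsGenSetBridge` (file D, `ker Q_{V1}(D) ⊆ T_𝐁` under the layer condition).

THE PRINT.  [III] = T. Bałaban, *Convergent renormalization expansions for lattice gauge theories*, CMP **119** (1988) `[Balaban1988Convergent]`, (2.1)–(2.2) p. 254–255: the sequence
`Ω_1 ⊃ Ω_2 ⊃ … ⊃ Ω_k` of unions of big cubes and its determining set `𝐁 = ⋃Γ_j`, `Γ₀ = Ω₁ᶜ`, `Γ_j = Ω_j^{(j)} ∖ Ω_{j+1}^{(j)}`, `Γ_k = Ω_k^{(k)}` (tree: `B14Eq218Concrete.Seq`,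
`B15DeterminingSets.genSet`, the record's `LargeFieldReprOfRecord.DOfRecord`); [B6] = CMP **96** (1984) `[Balaban1984PropagatorsII]` (2.1)–(2.3) p. 224: the same sequence as the index
structure `{Ω_j^{(j)}}`, `Λ_j = Ω_j^{(j)} ∖ Ω_{j+1}^{(j)}` of the propagator ∕ variational machinery (tree: lit-balaban's `B6SectADomainsV1.Domains`); [B11] = CMP **102** (1985)
`[Balaban1985Variational]` (150) p. 301: the per-cube family `Ω′_j` of Sect. F.  [I] CMP **109** p. 251 (0.1): *«Such a subset determines a set of lattice points, of a given scale,
belonging to it»* — for a region that is a union of `j`-blocks the three readings «centre in», «block inside», «block meets» coincide (SATURATION, displayed below as a hypothesis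
where used).

WHY.  The S4∕S5 rows of the K0 road are keyed on an abstract `D : B6SectADomainsV1.Domains (F.P K)`; the record's regions are the `Set`-valued `s.Ω j` of `B14Eq218Concrete.Seq`; no
`Domains`-inhabitant of the record existed (k0-s1-w3 g5, cell bus 2026-08-28 07:16Z).  THIS FILE defines it with NO side condition baked in — `Ω_j^{(j)} := {y : B^j(y) ⊆ Ω_i for
all 1 ≤ i ≤ j}` (nested BY CONSTRUCTION; equal to `{y : B^j(y) ⊆ Ω_j}` for a decreasing sequence and to `{y : embIter j y ∈ Ω_j}` under saturation) — and proves the dictionary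
with `genSet`, the monotonicity `Ω♭ ≤ Ω ⇒ domainsOfSeq Ω♭ ≤ domainsOfSeq Ω` (file A's order), and file D's LAYER CONDITION for every family below `domainsOfSeq Ω♭` whenever
`Ω♭_{j+1}` sits one `j`-block-layer inside `Ω_{j+1}` (set-level collar, displayed) — so that `cubeDomains ⊓ domainsOfSeq Ω♭` (Ω♭ = the record's regions shrunk by one big-cube layer)
carries `ker Q_{V1} ⊆ T_𝐁` at EVERY datum (LOCATED-INNER-INTERFACE-BONDS, cell bus 07:41Z).

WHAT IS PROVED (sorry-free; ONE definition; axioms standard; generic `P : Params`, any `Ω : ℕ → Set (Site P 0)`, any `k ≤ m + K`).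
* §0 `iterBlockOf_embIter_eq` (`B^j`-block point of the centre `embIter j y` is `y`), `blockOf_shift_or` ∕ `blockOf_unshift_or` (the block of a face-neighbour is the same or the
  face-neighbouring block; from `B10StarCount.blockOf_shift`).
* §1 ★ `domainsOfSeq Ω k hk : Domains P`; `domainsOfSeq_k`, `mem_domainsOfSeq_Om_iff` (raw), `domainsOfSeq_Om_of_gt`, ★ `mem_domainsOfSeq_Om_iff_subset` (decreasing `Ω`: `y ∈ Ω_j^{(j)}
  ↔ B^j(y) ⊆ Ω_j`, `1 ≤ j ≤ k`), ★ `mem_domainsOfSeq_Om_iff_centre` (+ saturation: `↔ embIter j y ∈ Ω_j`), `inOm_domainsOfSeq_iff` (`InOm j x ↔ x ∈ Ω_j`).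
* §2 ★★ `lamSite_domainsOfSeq_iff_mem_genSet` — SITES: V1's `Λ_j` of the family IS [III]'s `Γ_j^{(j)}`: `LamSite j y ↔ y ∈ genSet Ω k j` (every `j`; decreasing + saturated `Ω`);
  ★ `mem_bondsOf_genSet_of_lamBond_domainsOfSeq` — BONDS: every V1-indexed bond is a bond of `𝐁` (file D's `mem_bondsOf_genSet_of_lamBond`; the converse fails exactly for the inward
  crossing bonds — file D's header).
* §3 ★ `domainsOfSeq_le_of_subset` (`(∀ j, Ω♭ j ⊆ Ω j) → ∀ j, (domainsOfSeq Ω♭).Om j ⊆ (domainsOfSeq Ω).Om j`).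
* §4 ★★★ `layer_of_le_domainsOfSeq_of_collar` — for ANY family `D′` below `domainsOfSeq Ω♭ k` (`D′.Om ⊆ ·` levelwise, `D′.k ≤ k`) and regions with the SET-LEVEL COLLAR `hcol : ∀ j < k, ∀ y μ,
  B^{j+1}(blockOf y) ⊆ Ω♭_{j+1} → embIter j y ∈ Ω_{j+1} ∧ embIter j (y + e_μ) ∈ Ω_{j+1} ∧ embIter j (y − e_μ) ∈ Ω_{j+1}` («a (j+1)-block of Ω♭_{j+1} and the `j`-blocks face-adjacent to
  its sub-blocks are centred in Ω_{j+1}»), file D's layer condition holds: `∀ j < k, ∀ b, (D′.Deep j b₋ ∨ D′.Deep j b₊) → embIter j b₋ ∈ Ω_{j+1} ∧ embIter j b₊ ∈ Ω_{j+1}`; hence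
  ★★★ `bondAvgIter_eq_zero_on_genSet_of_le_domainsOfSeq` (`ker Q_{V1}(D′) ⊆ T_𝐁(Ω)` for such `D′`, by file D).
* §5 (v1.1, append-only) ★ `deep_domainsOfSeq_iff` (`Deep j y ↔ j < k ∧ embIter j y ∈ Ω_{j+1}`), ★★ `lamBond_domainsOfSeq_iff` ∕ `lamBond_zero_domainsOfSeq_iff` (the V1-indexed bonds = [B6]
  (2.3)'s EXCLUSIVE set in the sequence's letters — the bond set that the in-place (ii)-edition of `B15DeterminingSets.bondsOf` (cell pub-ymgap ME #35 ∕ plan (C) road) makes the record's).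
HONEST SCOPE.  Set∕lattice bookkeeping; the collar `hcol` (met by shrinking each `Ω_j`, `j ≥ 1`, by one layer of its big cubes — the record's `unionsOfCubes` letters) and (2.1)–(2.2)
admissibility `Adm22` of `domainsOfSeq` ∕ of the meet (Summits-side predicate) are NOT constructed here (Summits sequel ∕ k0-s1-w3's S5 geometry); nothing of [B11]'s analysis asserted;
`stub_prop8StepCoP13` ∕ K0⁷ NOT closed; N07 NOT discharged; counts unmoved (28∕28 · 5∕27); one finite 𝕋⁴ programme at fixed ε — the route closes the conditional finite-𝕋⁴ rung
`BalabanLadder.UV` only; nothing continuum ∕ ℝ⁴ ∕ OS ∕ mass gap ∕ Clay.  No `sorry`, no `instance`, no `notation`.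

References: [III] (2.1)–(2.2) pp. 254–255, (2.10)–(2.11) p. 256; [B6] (2.1)–(2.3) p. 224; [B11] (147)–(150) p. 301; [I] (0.1) p. 251, (0.3) p. 252.
-/

set_option autoImplicit false

namespace Literature.MathematicalPhysics.QuantumFieldTheory.Balaban1983to89.Node00

open LatticeFieldCalculus (bondAvgIter)
open B6SectADomainsV1 (Domains)
open B15DeterminingSets (embIter pts genSet gammaRegion bondsOf gammaRegion_of_gt gammaRegion_self gammaRegion_zero gammaRegion_mid)
open B5Eq118OneStroke (iterBlockOf iterBlockOf_zero iterBlockOf_succ)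
open B10StarCount (blockOf_shift shift_unshift unshift_shift)

variable {P : Params}

/-! ## §0  Lattice lemmas: the block point of a centre; blocks of face-neighbours -/

/-- The `j`-fold block point of the centre `embIter j y` is `y` (`blockOf ∘ emb = id`, iterated; standing range). [cite: Balaban1987RG1, (0.1)–(0.3) p.251–252] -/
theorem iterBlockOf_embIter_eq : ∀ {j : ℕ}, j ≤ P.m + P.K → ∀ y : Site P j, iterBlockOf j (embIter j y) = y
  | 0, _, y => rfl
  | j + 1, hj, y => by
    show blockOf (iterBlockOf j (embIter j (emb y))) = y
    rw [iterBlockOf_embIter_eq (Nat.le_of_succ_le hj) (emb y), Site.blockOf_emb hj]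

/-- The block of a face-neighbour `x + e_μ` is the block of `x` or its face-neighbour `blockOf x + e_μ`. [cite: Balaban1987RG1, (0.3) p.252] -/
theorem blockOf_shift_or {j : ℕ} (hj : j + 1 ≤ P.m + P.K) (x : Site P j) (μ : Fin P.d) :
    blockOf (x.shift μ) = blockOf x ∨ blockOf (x.shift μ) = (blockOf x).shift μ := by
  rw [blockOf_shift hj x μ]
  split_ifs
  · exact Or.inr rfl
  · exact Or.inl rfl

/-- The block of a face-neighbour `x − e_μ` is the block of `x` or its face-neighbour `blockOf x − e_μ`. [cite: Balaban1987RG1, (0.3) p.252] -/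
theorem blockOf_unshift_or {j : ℕ} (hj : j + 1 ≤ P.m + P.K) (x : Site P j) (μ : Fin P.d) :
    blockOf (x.unshift μ) = blockOf x ∨ blockOf (x.unshift μ) = (blockOf x).unshift μ := by
  rcases blockOf_shift_or hj (x.unshift μ) μ with h | h
  · rw [shift_unshift] at h
    exact Or.inl h.symm
  · rw [shift_unshift] at h
    right
    rw [h, unshift_shift]

/-! ## §1  The family `domainsOfSeq Ω k` -/

/-- ★ **The record's region sequence as a V1 nested family**: `k` levels; `Ω₀^{(0)} := T`; for `j ≤ k`, `Ω_j^{(j)} := {y : B^j(y) ⊆ Ω_i for every 1 ≤ i ≤ j}` (nested by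
construction — the `j`-block of `y` lies in the `(j+1)`-block of `blockOf y`); `∅` above `k`.  For a DECREASING sequence this is `{y : B^j(y) ⊆ Ω_j}`, and for regions that are unions of
`j`-blocks it is `{y : embIter j y ∈ Ω_j}` (§1 lemmas). [cite: Balaban1988Convergent, (2.1)–(2.2) p.254; Balaban1984PropagatorsII, (2.1)–(2.3) p.224] -/
noncomputable def domainsOfSeq (Ω : ℕ → Set (Site P 0)) (k : ℕ) (hk : k ≤ P.m + P.K) : Domains P where
  k := k
  hk := hk
  Om j := by
    classical
    exact if j ≤ k then Finset.univ.filter (fun y : Site P j => ∀ x : Site P 0, iterBlockOf j x = y → ∀ i : ℕ, 1 ≤ i → i ≤ j → x ∈ Ω i) else ∅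
  Om_zero := by
    classical
    rw [if_pos (Nat.zero_le k)]
    ext y
    simp only [Finset.mem_filter, Finset.mem_univ, true_and, iff_true]
    intro x _ i hi1 hi0
    omega
  Om_eq_empty j hj := by
    classical
    rw [if_neg (not_le.mpr hj)]
  nested j y hy := by
    classical
    by_cases hjk : j + 1 ≤ k
    · rw [if_pos hjk, Finset.mem_filter] at hy
      rw [if_pos (Nat.le_of_succ_le hjk), Finset.mem_filter]
      refine ⟨Finset.mem_univ _, fun x hx i hi1 hij => ?_⟩
      exact hy.2 x (by rw [iterBlockOf_succ, hx]) i hi1 (hij.trans (Nat.le_succ j))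
    · rw [if_neg hjk] at hy
      exact absurd hy (Finset.notMem_empty _)

/-- The family has `k` levels. [cite: Balaban1988Convergent, (2.1) p.254 (bookkeeping)] -/
theorem domainsOfSeq_k (Ω : ℕ → Set (Site P 0)) (k : ℕ) (hk : k ≤ P.m + P.K) : (domainsOfSeq Ω k hk).k = k := rfl

/-- Raw membership: for `j ≤ k`, `y ∈ Ω_j^{(j)}` iff every fine site of `B^j(y)` lies in `Ω_i` for all `1 ≤ i ≤ j`. [cite: Balaban1988Convergent, (2.1)–(2.2) p.254] -/
theorem mem_domainsOfSeq_Om_iff (Ω : ℕ → Set (Site P 0)) {k : ℕ} (hk : k ≤ P.m + P.K) {j : ℕ} (hjk : j ≤ k) (y : Site P j) :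
    y ∈ (domainsOfSeq Ω k hk).Om j ↔ ∀ x : Site P 0, iterBlockOf j x = y → ∀ i : ℕ, 1 ≤ i → i ≤ j → x ∈ Ω i := by
  classical
  show y ∈ (if j ≤ k then Finset.univ.filter (fun y : Site P j => ∀ x : Site P 0, iterBlockOf j x = y → ∀ i : ℕ, 1 ≤ i → i ≤ j → x ∈ Ω i) else ∅) ↔ _
  rw [if_pos hjk, Finset.mem_filter]
  simp

/-- Above the top level the regions are empty. [cite: Balaban1988Convergent, (2.1) p.254 (bookkeeping)] -/
theorem domainsOfSeq_Om_of_gt (Ω : ℕ → Set (Site P 0)) {k : ℕ} (hk : k ≤ P.m + P.K) {j : ℕ} (hkj : k < j) : (domainsOfSeq Ω k hk).Om j = ∅ :=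
  (domainsOfSeq Ω k hk).Om_eq_empty hkj

/-- ★ For a DECREASING sequence (`Ω_{i+1} ⊆ Ω_i`, `1 ≤ i < k`): `y ∈ Ω_j^{(j)}` iff `B^j(y) ⊆ Ω_j` (`1 ≤ j ≤ k`). [cite: Balaban1988Convergent, (2.1) p.254] -/
theorem mem_domainsOfSeq_Om_iff_subset (Ω : ℕ → Set (Site P 0)) {k : ℕ} (hk : k ≤ P.m + P.K)
    (hnest : ∀ i : ℕ, 1 ≤ i → i < k → Ω (i + 1) ⊆ Ω i) {j : ℕ} (hj1 : 1 ≤ j) (hjk : j ≤ k) (y : Site P j) :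
    y ∈ (domainsOfSeq Ω k hk).Om j ↔ ∀ x : Site P 0, iterBlockOf j x = y → x ∈ Ω j := by
  rw [mem_domainsOfSeq_Om_iff Ω hk hjk]
  constructor
  · exact fun h x hx => h x hx j hj1 le_rfl
  · intro h x hx i hi1 hij
    -- descend from `Ω_j` to `Ω_i` along the decreasing chain
    have key : ∀ n : ℕ, i + n ≤ k → 1 ≤ i → x ∈ Ω (i + n) → x ∈ Ω i := by
      intro n
      induction n with
      | zero => intro _ _ hx; simpa using hx
      | succ n ih =>
        intro hn hi hx
        exact ih (by omega) hi (hnest (i + n) (by omega) (by omega) (by simpa [Nat.add_assoc] using hx))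
    exact key (j - i) (by omega) hi1 (by rw [Nat.add_sub_cancel' hij]; exact h x hx)

/-- ★ Under SATURATION at level `j` (`Ω_j` a union of `j`-blocks: membership depends only on the `j`-block point) and for a decreasing sequence: `y ∈ Ω_j^{(j)}` iff the CENTRE
`embIter j y` lies in `Ω_j` — the reading of `B15DeterminingSets.pts` ([I] p.251 «lattice points belonging to it»). [cite: Balaban1987RG1, (0.1) p.251; Balaban1988Convergent, (2.2) p.255] -/
theorem mem_domainsOfSeq_Om_iff_centre (Ω : ℕ → Set (Site P 0)) {k : ℕ} (hk : k ≤ P.m + P.K)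
    (hnest : ∀ i : ℕ, 1 ≤ i → i < k → Ω (i + 1) ⊆ Ω i)
    (hsat : ∀ (j : ℕ) (x x' : Site P 0), 1 ≤ j → j ≤ k → iterBlockOf j x = iterBlockOf j x' → x ∈ Ω j → x' ∈ Ω j)
    {j : ℕ} (hj1 : 1 ≤ j) (hjk : j ≤ k) (y : Site P j) :
    y ∈ (domainsOfSeq Ω k hk).Om j ↔ embIter j y ∈ Ω j := by
  rw [mem_domainsOfSeq_Om_iff_subset Ω hk hnest hj1 hjk]
  have hcen : iterBlockOf j (embIter j y) = y := iterBlockOf_embIter_eq (hjk.trans hk) y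
  constructor
  · exact fun h => h _ hcen
  · intro h x hx
    exact hsat j (embIter j y) x hj1 hjk (by rw [hcen, hx]) h

/-- `InOm j x` (the fine site `x` lies in `Ω_j = B^j(Ω_j^{(j)})`) iff `x ∈ Ω_j`, for `1 ≤ j ≤ k`, decreasing saturated regions. [cite: Balaban1984PropagatorsII, (2.2) p.224] -/
theorem inOm_domainsOfSeq_iff (Ω : ℕ → Set (Site P 0)) {k : ℕ} (hk : k ≤ P.m + P.K)
    (hnest : ∀ i : ℕ, 1 ≤ i → i < k → Ω (i + 1) ⊆ Ω i)
    (hsat : ∀ (j : ℕ) (x x' : Site P 0), 1 ≤ j → j ≤ k → iterBlockOf j x = iterBlockOf j x' → x ∈ Ω j → x' ∈ Ω j)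
    {j : ℕ} (hj1 : 1 ≤ j) (hjk : j ≤ k) (x : Site P 0) :
    (domainsOfSeq Ω k hk).InOm j x ↔ x ∈ Ω j := by
  show iterBlockOf j x ∈ (domainsOfSeq Ω k hk).Om j ↔ x ∈ Ω j
  rw [mem_domainsOfSeq_Om_iff_subset Ω hk hnest hj1 hjk]
  constructor
  · exact fun h => h x rfl
  · intro h x' hx'
    exact hsat j x x' hj1 hjk hx'.symm h

/-! ## §2  Dictionary with the determining set `genSet Ω k` -/

/-- ★★ **V1's `Λ_j` IS [III]'s `Γ_j^{(j)}`** (sites): for a decreasing, saturated sequence and every level `j`, `(domainsOfSeq Ω k).LamSite j y ↔ y ∈ genSet Ω k j` — at `j = 0`: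
`¬Deep ↔ y ∉ Ω₁`; at `1 ≤ j < k`: `y ∈ Ω_j^{(j)} ∧ ¬Deep ↔ embIter j y ∈ Ω_j ∖ Ω_{j+1}`; at `j = k`: `Ω_k^{(k)}`; above: both empty. [cite: Balaban1988Convergent, (2.2) p.255; Balaban1984PropagatorsII, (2.3) p.224] -/
theorem lamSite_domainsOfSeq_iff_mem_genSet (Ω : ℕ → Set (Site P 0)) {k : ℕ} (hk : k ≤ P.m + P.K) (hk1 : 1 ≤ k)
    (hnest : ∀ i : ℕ, 1 ≤ i → i < k → Ω (i + 1) ⊆ Ω i)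
    (hsat : ∀ (j : ℕ) (x x' : Site P 0), 1 ≤ j → j ≤ k → iterBlockOf j x = iterBlockOf j x' → x ∈ Ω j → x' ∈ Ω j)
    (j : ℕ) (y : Site P j) :
    (domainsOfSeq Ω k hk).LamSite j y ↔ y ∈ genSet Ω k j := by
  -- deepness at level `j < k` reads «centre in Ω_{j+1}»
  have hdeep : ∀ {j : ℕ} (y : Site P j), j < k → ((domainsOfSeq Ω k hk).Deep j y ↔ embIter j y ∈ Ω (j + 1)) := by
    intro j y hj
    show blockOf y ∈ (domainsOfSeq Ω k hk).Om (j + 1) ↔ _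
    rw [mem_domainsOfSeq_Om_iff_subset Ω hk hnest (by omega) (by omega)]
    have hcen : iterBlockOf (j + 1) (embIter j y) = blockOf y := by
      rw [iterBlockOf_succ, iterBlockOf_embIter_eq (by omega) y]
    constructor
    · exact fun h => h _ hcen
    · intro h x hx
      exact hsat (j + 1) (embIter j y) x (by omega) (by omega) (by rw [hcen, hx]) h
  show (domainsOfSeq Ω k hk).LamSite j y ↔ embIter j y ∈ gammaRegion Ω k j
  rcases lt_trichotomy j k with hjk | rfl | hkj
  · rcases Nat.eq_zero_or_pos j with rfl | hj0
    · rw [(domainsOfSeq Ω k hk).lamSite_zero_iff, gammaRegion_zero Ω hk1, hdeep y hjk]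
      rfl
    · rw [gammaRegion_mid Ω hj0 hjk]
      show y ∈ (domainsOfSeq Ω k hk).Om j ∧ ¬ (domainsOfSeq Ω k hk).Deep j y ↔ embIter j y ∈ Ω j ∧ embIter j y ∉ Ω (j + 1)
      rw [mem_domainsOfSeq_Om_iff_centre Ω hk hnest hsat hj0 hjk.le, hdeep y hjk]
  · have htop : (domainsOfSeq Ω j hk).LamSite j y ↔ y ∈ (domainsOfSeq Ω j hk).Om j := (domainsOfSeq Ω j hk).lamSite_top_iff y
    rw [gammaRegion_self, htop, mem_domainsOfSeq_Om_iff_centre Ω hk hnest hsat hk1 le_rfl]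
  · rw [gammaRegion_of_gt Ω hkj]
    simp [(domainsOfSeq Ω k hk).not_lamSite_of_lt hkj]

/-- ★ **Every V1-indexed bond of the family is a bond of `𝐁`** (exclusive ⊆ inclusive; file D `mem_bondsOf_genSet_of_lamBond` with its two readings discharged): for a decreasing,
saturated sequence with `k ≥ 1`, `(domainsOfSeq Ω k).LamBond j b → b ∈ bondsOf (genSet Ω k j)`. [cite: Balaban1984PropagatorsII, (2.3) p.224; Balaban1988Convergent, (2.2) p.255] -/
theorem mem_bondsOf_genSet_of_lamBond_domainsOfSeq (Ω : ℕ → Set (Site P 0)) {k : ℕ} (hk : k ≤ P.m + P.K) (hk1 : 1 ≤ k)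
    (hnest : ∀ i : ℕ, 1 ≤ i → i < k → Ω (i + 1) ⊆ Ω i)
    (hsat : ∀ (j : ℕ) (x x' : Site P 0), 1 ≤ j → j ≤ k → iterBlockOf j x = iterBlockOf j x' → x ∈ Ω j → x' ∈ Ω j)
    {j : ℕ} {b : PBond P j} (hb : (domainsOfSeq Ω k hk).LamBond j b) : b ∈ bondsOf (genSet Ω k j) := by
  refine mem_bondsOf_genSet_of_lamBond (domainsOfSeq Ω k hk) Ω hk1 (fun i hi1 hik y => mem_domainsOfSeq_Om_iff_centre Ω hk hnest hsat hi1 hik y) ?_ hb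
  intro i hi y
  have hi' : i < k := hi
  have hcen : iterBlockOf (i + 1) (embIter i y) = blockOf y := by
    rw [iterBlockOf_succ, iterBlockOf_embIter_eq (by show i ≤ P.m + P.K; exact (Nat.le_of_lt hi).trans hk) y]
  have hcen' : iterBlockOf (i + 1) (embIter (i + 1) (blockOf y)) = blockOf y :=
    iterBlockOf_embIter_eq (by show i + 1 ≤ P.m + P.K; exact (Nat.succ_le_of_lt hi).trans hk) (blockOf y)
  constructor
  · exact fun h => hsat (i + 1) _ _ (by omega) (by omega) (by rw [hcen', hcen]) h
  · exact fun h => hsat (i + 1) _ _ (by omega) (by omega) (by rw [hcen, hcen']) h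

/-! ## §3  Monotonicity in the regions: shrunk regions give a finer family -/

/-- ★ Shrinking the regions levelwise refines the family: `(∀ j, Ω♭_j ⊆ Ω_j) → domainsOfSeq Ω♭ ≤ domainsOfSeq Ω` (file A's refinement order, levelwise inclusion of `Om`).
[cite: Balaban1985Variational, (150) p.301; Balaban1988Convergent, (2.1) p.254] -/
theorem domainsOfSeq_le_of_subset {Ω' Ω : ℕ → Set (Site P 0)} (h : ∀ j, Ω' j ⊆ Ω j) {k : ℕ} (hk : k ≤ P.m + P.K) :
    ∀ j : ℕ, (domainsOfSeq Ω' k hk).Om j ⊆ (domainsOfSeq Ω k hk).Om j := by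
  intro j y hy
  by_cases hjk : j ≤ k
  · rw [mem_domainsOfSeq_Om_iff Ω' hk hjk] at hy
    rw [mem_domainsOfSeq_Om_iff Ω hk hjk]
    exact fun x hx i hi1 hij => h i (hy x hx i hi1 hij)
  · rw [domainsOfSeq_Om_of_gt Ω' hk (not_le.mp hjk)] at hy
    exact absurd hy (Finset.notMem_empty _)

/-! ## §4  The layer condition of file D from a set-level collar -/

/-- ★★★ **The layer condition from a one-block collar.**  Let `Ω♭` and `Ω` be region sequences with the SET-LEVEL COLLAR: whenever the `(j+1)`-block of a `j`-site `y` lies in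
`Ω♭_{j+1}` (all its fine sites), the centres of `y` and of its face-neighbours `y ± e_μ` lie in `Ω_{j+1}` (`j < k`).  Then EVERY family `D′` below `domainsOfSeq Ω♭ k` (levelwise
`D′.Om ⊆ ·`) satisfies file D's layer condition for `Ω`: a level-`j` bond with a `D′`-deep end-point has both end-points centred in `Ω_{j+1}`.  (At the record: `Ω♭` = the regions
shrunk by one layer of big cubes, `D′ = cubeDomains ⊓ domainsOfSeq Ω♭` — the per-cube family of [B11] (150) at any datum.) [cite: Balaban1985Variational, (150) p.301; Balaban1984PropagatorsII, (2.2)–(2.3) p.224] -/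
theorem layer_of_le_domainsOfSeq_of_collar {Ω' Ω : ℕ → Set (Site P 0)} {k : ℕ} (hk : k ≤ P.m + P.K)
    (hcol : ∀ j : ℕ, j < k → ∀ (y : Site P j) (μ : Fin P.d), (∀ x : Site P 0, iterBlockOf (j + 1) x = blockOf y → x ∈ Ω' (j + 1)) →
      embIter j y ∈ Ω (j + 1) ∧ embIter j (y.shift μ) ∈ Ω (j + 1) ∧ embIter j (y.unshift μ) ∈ Ω (j + 1))
    {D' : Domains P} (hle : ∀ j : ℕ, D'.Om j ⊆ (domainsOfSeq Ω' k hk).Om j) :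
    ∀ j : ℕ, j < k → ∀ b : PBond P j, (D'.Deep j b.src ∨ D'.Deep j b.tgt) → embIter j b.src ∈ Ω (j + 1) ∧ embIter j b.tgt ∈ Ω (j + 1) := by
  intro j hj b hdeep
  -- a `D′`-deep `j`-site has its `(j+1)`-block inside `Ω♭_{j+1}` (descend from the raw membership at level `j+1`, index `i := j+1`)
  have hblock : ∀ {y : Site P j}, D'.Deep j y → ∀ x : Site P 0, iterBlockOf (j + 1) x = blockOf y → x ∈ Ω' (j + 1) := by
    intro y hy x hx
    have hmem := hle (j + 1) hy
    rw [mem_domainsOfSeq_Om_iff Ω' hk (Nat.succ_le_of_lt hj)] at hmem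
    exact hmem x hx (j + 1) (Nat.succ_le_succ (Nat.zero_le j)) le_rfl
  have htgt : b.tgt = b.src.shift b.dir := rfl
  have hsrc : b.src = b.tgt.unshift b.dir := by rw [htgt, unshift_shift]
  rcases hdeep with hs | ht
  · obtain ⟨h0, hplus, -⟩ := hcol j hj b.src b.dir (hblock hs)
    exact ⟨h0, by rw [htgt]; exact hplus⟩
  · obtain ⟨h0, -, hminus⟩ := hcol j hj b.tgt b.dir (hblock ht)
    exact ⟨by rw [hsrc]; exact hminus, h0⟩

/-- ★★★ **`ker Q_{V1}(D′) ⊆ T_𝐁(Ω)` for every per-cube family below the shrunk record family**: under the collar of `layer_of_le_domainsOfSeq_of_collar` and `D′.k ≤ k`, if the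
straight averages of `A` vanish on every `D′`-indexed bond then they vanish on every bond of the record's determining set `genSet Ω k` (file D). [cite: Balaban1985Variational, (150) p.301; Balaban1988Convergent, (2.10)–(2.11) p.256] -/
theorem bondAvgIter_eq_zero_on_genSet_of_le_domainsOfSeq {Ω' Ω : ℕ → Set (Site P 0)} {k : ℕ} (hk : k ≤ P.m + P.K)
    (hcol : ∀ j : ℕ, j < k → ∀ (y : Site P j) (μ : Fin P.d), (∀ x : Site P 0, iterBlockOf (j + 1) x = blockOf y → x ∈ Ω' (j + 1)) →
      embIter j y ∈ Ω (j + 1) ∧ embIter j (y.shift μ) ∈ Ω (j + 1) ∧ embIter j (y.unshift μ) ∈ Ω (j + 1))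
    {D' : Domains P} (hle : ∀ j : ℕ, D'.Om j ⊆ (domainsOfSeq Ω' k hk).Om j) (hk' : D'.k ≤ k)
    {A : VecField P 0 ℝ} (hA : ∀ (i : ℕ) (b : PBond P i), D'.LamBond i b → bondAvgIter i A b = 0)
    {j : ℕ} {b : PBond P j} (hb : b ∈ bondsOf (genSet Ω k j)) : bondAvgIter j A b = 0 :=
  bondAvgIter_eq_zero_of_mem_bondsOf_genSet D' Ω k hk' (layer_of_le_domainsOfSeq_of_collar hk hcol hle) hA hb

/-! ## §5 (v1.1, APPEND-ONLY — §0–§4 byte-identical)  Deepness and the indexed BONDS of `domainsOfSeq` in the sequence's letters -/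

/-- ★ **Deepness read on the sequence**: for a decreasing, saturated sequence, a `j`-site is DEEP for `domainsOfSeq Ω k` iff `j < k` and its centre lies in `Ω_{j+1}`.
[cite: Balaban1984PropagatorsII, (2.3) p.224; Balaban1988Convergent, (2.2) p.255] -/
theorem deep_domainsOfSeq_iff (Ω : ℕ → Set (Site P 0)) {k : ℕ} (hk : k ≤ P.m + P.K)
    (hnest : ∀ i : ℕ, 1 ≤ i → i < k → Ω (i + 1) ⊆ Ω i)
    (hsat : ∀ (j : ℕ) (x x' : Site P 0), 1 ≤ j → j ≤ k → iterBlockOf j x = iterBlockOf j x' → x ∈ Ω j → x' ∈ Ω j)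
    {j : ℕ} (y : Site P j) :
    (domainsOfSeq Ω k hk).Deep j y ↔ j < k ∧ embIter j y ∈ Ω (j + 1) := by
  by_cases hj : j < k
  · show blockOf y ∈ (domainsOfSeq Ω k hk).Om (j + 1) ↔ _
    rw [mem_domainsOfSeq_Om_iff_subset Ω hk hnest (by omega) (by omega)]
    have hcen : iterBlockOf (j + 1) (embIter j y) = blockOf y := by
      rw [iterBlockOf_succ, iterBlockOf_embIter_eq (by omega) y]
    constructor
    · exact fun h => ⟨hj, h _ hcen⟩
    · rintro ⟨-, h⟩ x hx
      exact hsat (j + 1) (embIter j y) x (by omega) (by omega) (by rw [hcen, hx]) h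
  · have hnd : ¬ (domainsOfSeq Ω k hk).Deep j y := (domainsOfSeq Ω k hk).not_deep_of_le (show (domainsOfSeq Ω k hk).k ≤ j from not_lt.mp hj) y
    simp [hnd, hj]

/-- ★★ **The V1-indexed bonds of `domainsOfSeq` in the sequence's letters** ([B6] (2.3) `Λ_j = st(Ω_j) ∖ st(Ω_{j+1})`, the EXCLUSIVE set; cell pub-ymgap ME #35: print's own): for
`1 ≤ j ≤ k`, a `j`-bond is indexed iff an end-point is centred in `Ω_j` and NO end-point is centred in `Ω_{j+1}` (the latter void at `j = k`); at `j = 0` iff no end-point is centred in `Ω₁`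
(for `k ≥ 1`).  Compare [III]'s `bondsOf (genSet Ω k j)` = «an end-point centred in `Γ_j`» (reading (b), the INCLUSIVE set, larger exactly by the inward crossing bonds — `Node00/GenSetVsLamBond`,
file D's header). [cite: Balaban1984PropagatorsII, (2.3) p.224; Balaban1988Convergent, (2.2) p.255] -/
theorem lamBond_domainsOfSeq_iff (Ω : ℕ → Set (Site P 0)) {k : ℕ} (hk : k ≤ P.m + P.K)
    (hnest : ∀ i : ℕ, 1 ≤ i → i < k → Ω (i + 1) ⊆ Ω i)
    (hsat : ∀ (j : ℕ) (x x' : Site P 0), 1 ≤ j → j ≤ k → iterBlockOf j x = iterBlockOf j x' → x ∈ Ω j → x' ∈ Ω j)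
    {j : ℕ} (hj1 : 1 ≤ j) (hjk : j ≤ k) (b : PBond P j) :
    (domainsOfSeq Ω k hk).LamBond j b ↔
      (embIter j b.src ∈ Ω j ∨ embIter j b.tgt ∈ Ω j) ∧ (j < k → embIter j b.src ∉ Ω (j + 1) ∧ embIter j b.tgt ∉ Ω (j + 1)) := by
  show ((b.src ∈ (domainsOfSeq Ω k hk).Om j ∨ b.tgt ∈ (domainsOfSeq Ω k hk).Om j) ∧ ¬ (domainsOfSeq Ω k hk).Deep j b.src ∧ ¬ (domainsOfSeq Ω k hk).Deep j b.tgt) ↔ _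
  rw [mem_domainsOfSeq_Om_iff_centre Ω hk hnest hsat hj1 hjk, mem_domainsOfSeq_Om_iff_centre Ω hk hnest hsat hj1 hjk,
    deep_domainsOfSeq_iff Ω hk hnest hsat, deep_domainsOfSeq_iff Ω hk hnest hsat]
  by_cases hj : j < k
  · simp [hj]
  · simp [hj]

/-- The same at level `0` (`Ω₀ = T`): a fine bond is indexed iff no end-point lies in `Ω₁` (`k ≥ 1`; `embIter 0 = id`). [cite: Balaban1984PropagatorsII, (2.3) p.224] -/
theorem lamBond_zero_domainsOfSeq_iff (Ω : ℕ → Set (Site P 0)) {k : ℕ} (hk : k ≤ P.m + P.K) (hk1 : 1 ≤ k)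
    (hnest : ∀ i : ℕ, 1 ≤ i → i < k → Ω (i + 1) ⊆ Ω i)
    (hsat : ∀ (j : ℕ) (x x' : Site P 0), 1 ≤ j → j ≤ k → iterBlockOf j x = iterBlockOf j x' → x ∈ Ω j → x' ∈ Ω j)
    (b : PBond P 0) :
    (domainsOfSeq Ω k hk).LamBond 0 b ↔ b.src ∉ Ω 1 ∧ b.tgt ∉ Ω 1 := by
  have h0k : 0 < k := hk1
  rw [(domainsOfSeq Ω k hk).lamBond_zero_iff, deep_domainsOfSeq_iff Ω hk hnest hsat, deep_domainsOfSeq_iff Ω hk hnest hsat]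
  show ¬ (0 < k ∧ b.src ∈ Ω 1) ∧ ¬ (0 < k ∧ b.tgt ∈ Ω 1) ↔ b.src ∉ Ω 1 ∧ b.tgt ∉ Ω 1
  simp [h0k]

end Literature.MathematicalPhysics.QuantumFieldTheory.Balaban1983to89.Node00
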